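import Summits.ResolutionOfSingularities.ResolutionOfSingularities.Theorems.PurelyInseparableDim4ResConeThreeWeights
import Summits.ResolutionOfSingularities.ResolutionOfSingularities.Theorems.PurelyInseparableDim4ResConeBinaryPairTail
import HarnessLib
import HarnessLib.Audit.Tags

/-!
# Purely inseparable four-folds — the LIGHT-LOSSY class at `(p,d) = (5,3)` in kernel letters: on the light branch `(1,1,1)`
# every step is either LOSS-FREE with a boundary chart letter or LOSSY with the FREE chart letter and exactly one boundary
# letter translated; and a kernel vector never charted again is zero (cell `res-dim4-pi`, K2(p) lane, slice C; holder brick L0)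

[OURS · counted 0 · cell `res-dim4-pi` · K2(p) lane holder res-dim4-p-12 g4 (memo §17: the located gap «LIGHT LOSSY binary-cone
tails at (5,3)» stated in kernel letters).]  Nothing here proves K2(5) (`RidgeBudget.NoAboveFloorTrap 5 5`), `NoIsolatedTrap 5 5`
or resolution of singularities in dimension ≥ 4 / characteristic `p` — NOT proved; the light-lossy class itself is NOT killed
here.  AI kernel work, weaker than expert review.

* §1 (any `p`, constant `(d, e_G = 2)` tail) **`eq_zero_of_forall_chart_apply_eq_zero`** — a vector of the polar kernel
  `resVertex (c k)` whose coordinate at EVERY later chart letter `j n` (`n ≥ k`) vanishes is zero: it persists by (I2)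
  (`chain_resVertex_step_inf_hyperplane_eq`, res-dim4-p-5 g2), and at the next satellite step (FT) the direction would be a
  multiple of it ((SAT-PREDICTED) `chain_satellite_direction_eq_smul`) with a vanishing chart coordinate.  This is
  res-dim4-p-5 g3's C8 `no_passive_kernel_vector` with the pair hypothesis `hletters` replaced by its only use; corollary
  `exists_chart_apply_ne_zero`.
* §2 (`p = 5`, shade `3`, light branch of brick W `three_weights_dichotomy`: `|r_k| = 3`, all weights `≤ 1` for `k ≥ k₀`)
  `translated_degree_add_apply_chart` (core: `|hit weight| = 1` per step), **`light_step_cases`**: every step `k ≥ k₀` is EITHER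
  loss-free with a boundary chart letter (`1 ≤ (c k).r (j k)`, no boundary letter translated) OR lossy with the free chart
  letter (`(c k).r (j k) = 0`) and EXACTLY ONE boundary letter translated; `lossy_step_shape` spells the second case out
  (the translated letter becomes free, the free chart letter becomes the newborn boundary letter).
The loss-free light tails are dead (`ResCone.no_lossfree_tail`, p684130); the LOSSY light tails — infinitely many steps of
the second kind — are the open item this vocabulary is for.

[cite: CossartJannsenSaito2020, Thm. 3.10(4), Thm. 3.14] [cite: HauserPerlega2019PRIMS, §2 (transform D′ of D)]
bears_on: LADDER-RESOLUTION:D157-DOOR2 (res-dim4-pi · K2(p) · slice C `(5,3)` light-lossy vocabulary).  Supports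
stmt-ResolutionOfSingularities-16155 (helper).
-/

set_option linter.dupNamespace false -- mandated namespace of this single-conjunct summit

noncomputable section

namespace Summit.ResolutionOfSingularities.ResolutionOfSingularities.Theorems.PIDim4

namespace ResCone

open MvPolynomial Finset
open Literature.AlgebraicGeometry.Resolution
open Literature.AlgebraicGeometry.Resolution.CentreBlowup
open Literature.AlgebraicGeometry.Resolution.Hauser2010
open Literature.AlgebraicGeometry.Resolution.HauserPerlega2019
open PointBlowup (polarMap additiveSubspace direction)

variable {K : Type} [Field K]

/-! ## 1. A kernel vector that is never charted again is zero -/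

section Kernel

variable (p : ℕ) [Fact p.Prime] [CharP K p] [DecidableEq K]

/-- **NO UNCHARTED KERNEL VECTOR** on a constant-`(d, e_G = 2)` tail of an isolated above-floor witnessed `Step0 p` chain with
`x^{r₀} ∣ F₀`: if `w ∈ resVertex (c k)` has `w (j n) = 0` for every `n ≥ k`, then `w = 0`.  (Persistence by (I2); at the next
satellite step — which exists by FT — the direction is a multiple of `w` (SAT-PREDICTED), so `w (j (n+1)) ≠ 0`.)  Generalises
res-dim4-p-5 g3's `no_passive_kernel_vector` (chart letters in a pair, `w` vanishing on the pair). [OURS]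
[cite: CossartJannsenSaito2020, Thm. 3.10(4), Thm. 3.14] -/
theorem eq_zero_of_forall_chart_apply_eq_zero {c : ℕ → State K} {j : ℕ → Fin 4} {b : ℕ → Fin 4 → K}
    (hc : ∀ k, IsIsolated p (c k).F ∧ Step0 p (c k) (c (k + 1))) (hw : FreeTail.IsWitnessedChain p c j b)
    (hr0 : ∀ e ∈ (c 0).F.support, (c 0).r ≤ e) (hfloor : ∀ k, ordZero (c k).F ≠ p) {k₀ : ℕ} {d : ℕ∞}
    (hshade : ∀ k, k₀ ≤ k → (c k).shade = d) (he : ∀ k, k₀ ≤ k → Module.finrank K (resVertex (c k)) = 2)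
    {k : ℕ} (hk : k₀ ≤ k) {w : Fin 4 → K} (hwV : w ∈ resVertex (c k)) (hwj : ∀ n, k ≤ n → w (j n) = 0) :
    w = 0 := by
  by_contra hw0
  -- the vector persists
  have hpers : ∀ n, w ∈ resVertex (c (k + n)) := by
    intro n
    induction n with
    | zero => simpa using hwV
    | succ n ih =>
      have hI2 := chain_resVertex_step_inf_hyperplane_eq p hc hw hr0 hfloor hshade he (k := k + n) (by omega)
      have hmem : w ∈ resVertex (c (k + n)) ⊓ hyperplane (j (k + n)) :=
        Submodule.mem_inf.mpr ⟨ih, mem_hyperplane.mpr (hwj (k + n) (by omega))⟩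
      rw [← hI2, show k + n + 1 = k + (n + 1) by ring] at hmem
      exact (Submodule.mem_inf.mp hmem).1
  -- a satellite step occurs after `k`
  have hsat : ∃ n, k ≤ n ∧ FreeTail.IsSatellite j b n := by
    by_contra h
    push Not at h
    obtain ⟨m, hm⟩ := FreeTailProof.noIsolatedFreeTailAt_self p K c j b k hw h
    exact hm (hc m).1
  obtain ⟨n, hkn, hsatn⟩ := hsat
  obtain ⟨i, rfl⟩ : ∃ i, n = k + i := ⟨n - k, by omega⟩
  have h := chain_satellite_direction_eq_smul p hc hw hr0 hfloor hshade (k := k + i) (by omega) hsatn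
    (by rw [he (k + i) (by omega)]) (hpers i) (hwj (k + i) (by omega)) hw0
  exact h.1 (hwj (k + i + 1) (by omega))

/-- **Every non-zero kernel vector is eventually charted**: `w ∈ resVertex (c k)`, `w ≠ 0` ⇒ `w (j n) ≠ 0` for some `n ≥ k`.
[OURS] [cite: CossartJannsenSaito2020, Thm. 3.14] -/
theorem exists_chart_apply_ne_zero {c : ℕ → State K} {j : ℕ → Fin 4} {b : ℕ → Fin 4 → K}
    (hc : ∀ k, IsIsolated p (c k).F ∧ Step0 p (c k) (c (k + 1))) (hw : FreeTail.IsWitnessedChain p c j b)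
    (hr0 : ∀ e ∈ (c 0).F.support, (c 0).r ≤ e) (hfloor : ∀ k, ordZero (c k).F ≠ p) {k₀ : ℕ} {d : ℕ∞}
    (hshade : ∀ k, k₀ ≤ k → (c k).shade = d) (he : ∀ k, k₀ ≤ k → Module.finrank K (resVertex (c k)) = 2)
    {k : ℕ} (hk : k₀ ≤ k) {w : Fin 4 → K} (hwV : w ∈ resVertex (c k)) (hw0 : w ≠ 0) :
    ∃ n, k ≤ n ∧ w (j n) ≠ 0 := by
  by_contra h
  push Not at h
  exact hw0 (eq_zero_of_forall_chart_apply_eq_zero p hc hw hr0 hfloor hshade he hk hwV h)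

end Kernel

/-! ## 2. The light branch at `p = 5`: loss-free steps chart a boundary letter, lossy steps chart the free letter -/

section Light

variable [DecidableEq K]

/-- **Hit-weight identity**: under the boundary law, the weight translated away plus the weight of the chart letter satisfies
`|translated| + r_k (j k) + |r_{k+1}| + 2 = 2·|r_k|`. [folklore] -/
theorem translated_degree_add_apply_chart {r : ℕ → Fin 4 →₀ ℕ} {j : ℕ → Fin 4} {b : ℕ → Fin 4 → K} {k : ℕ}
    (hlaw : r (k + 1) = ((r k).filter (fun i => b k i = 0)).update (j k) ((r k).degree - 2))
    (hbj : b k (j k) = 0) (h2 : 2 ≤ (r k).degree) :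
    ((r k).filter (fun i => ¬ b k i = 0)).degree + r k (j k) + (r (k + 1)).degree + 2 = 2 * (r k).degree := by
  set f : Fin 4 →₀ ℕ := (r k).filter (fun i => b k i = 0) with hf
  set g : Fin 4 →₀ ℕ := (r k).filter (fun i => ¬ b k i = 0) with hg
  have h1 : (r (k + 1)).degree + f (j k) = f.degree + ((r k).degree - 2) := by
    have e1 : r (k + 1) = f.erase (j k) + Finsupp.single (j k) ((r k).degree - 2) := by
      rw [hlaw, Finsupp.update_eq_erase_add_single]
    have e2 : f = f.erase (j k) + Finsupp.single (j k) (f (j k)) := (Finsupp.erase_add_single (j k) f).symm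
    have d1 := congrArg Finsupp.degree e1
    have d2 := congrArg Finsupp.degree e2
    rw [map_add, Finsupp.degree_single] at d1 d2
    omega
  have h2' : f.degree + g.degree = (r k).degree := by
    rw [← map_add, hf, hg, Finsupp.filter_add_filter_not]
  have h3 : f (j k) = r k (j k) := by rw [hf, Finsupp.filter_apply, if_pos hbj]
  omega

/-- A Finsupp of degree `0` vanishes everywhere; of degree `1` with all values `≤ 1` it is a single point. [folklore] -/
theorem degree_filter_not_eq_zero_iff {f : Fin 4 →₀ ℕ} {P : Fin 4 → Prop} [DecidablePred P] :
    (f.filter P).degree = 0 ↔ ∀ i, P i → f i = 0 := by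
  rw [Finsupp.degree_eq_zero_iff]
  constructor
  · intro h i hi
    have := DFunLike.congr_fun h i
    rwa [Finsupp.filter_apply, if_pos hi] at this
  · intro h
    ext i
    rw [Finsupp.filter_apply]
    split_ifs with hi
    · exact h i hi
    · rfl

/-- **LIGHT STEP DICHOTOMY** (`p = 5`, shade `3`, light branch): along a witnessed isolated above-floor `Step0 5` chain with
`x^{r₀} ∣ F₀`, constant shade `3` and `|r_k| = 3` with all weights `≤ 1` from `k₀`, every step `k ≥ k₀` is EITHER loss-free with a
BOUNDARY chart letter (`(c k).r (j k) = 1` and no boundary letter is translated) OR lossy with the FREE chart letter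
(`(c k).r (j k) = 0`) and total translated boundary weight exactly `1`. [OURS] [cite: CossartJannsenSaito2020, Thm. 3.14] -/
theorem light_step_cases {c : ℕ → State K} {j : ℕ → Fin 4} {b : ℕ → Fin 4 → K}
    (hc : ∀ k, IsIsolated 5 (c k).F ∧ Step0 5 (c k) (c (k + 1))) (hw : FreeTail.IsWitnessedChain 5 c j b)
    (hr0 : ∀ e ∈ (c 0).F.support, (c 0).r ≤ e) (hfloor : ∀ k, ordZero (c k).F ≠ 5) {k₀ : ℕ}
    (hshade : ∀ k, k₀ ≤ k → (c k).shade = ((3 : ℕ) : ℕ∞))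
    (hlight : ∀ k, k₀ ≤ k → (∀ i, (c k).r i ≤ 1) ∧ (c k).r.degree = 3) {k : ℕ} (hk : k₀ ≤ k) :
    ((c k).r (j k) = 1 ∧ ∀ i, b k i ≠ 0 → (c k).r i = 0) ∨
    ((c k).r (j k) = 0 ∧ ((c k).r.filter (fun i => ¬ b k i = 0)).degree = 1) := by
  obtain ⟨-, hlaw, hbj, -, -⟩ := three_weights_laws hc hw hr0 hfloor hshade
  have hid := translated_degree_add_apply_chart (r := fun k => (c k).r) (hlaw k hk) (hbj k)
    (by simp only [(hlight k hk).2]; norm_num)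
  rw [(hlight k hk).2, (hlight (k + 1) (by omega)).2] at hid
  have hj1 := (hlight k hk).1 (j k)
  rcases Nat.lt_or_ge ((c k).r (j k)) 1 with h0 | h1
  · right
    exact ⟨by omega, by omega⟩
  · left
    refine ⟨by omega, fun i hbi => ?_⟩
    have hdeg0 : ((c k).r.filter (fun i => ¬ b k i = 0)).degree = 0 := by omega
    exact (degree_filter_not_eq_zero_iff.mp hdeg0) i hbi

/-- **SHAPE OF A LOSSY LIGHT STEP**: in the light branch, if step `k ≥ k₀` translates a boundary letter `x`
(`b k x ≠ 0`, `(c k).r x = 1`), then the chart letter is FREE at `k` (`(c k).r (j k) = 0`), `x` is the ONLY translated boundary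
letter, `x` is free at `k + 1`, and the chart letter is the newborn boundary letter of weight `1` at `k + 1`. [OURS]
[cite: CossartJannsenSaito2020, Thm. 3.14] [cite: HauserPerlega2019PRIMS, §2 (transform D′ of D)] -/
theorem lossy_step_shape {c : ℕ → State K} {j : ℕ → Fin 4} {b : ℕ → Fin 4 → K}
    (hc : ∀ k, IsIsolated 5 (c k).F ∧ Step0 5 (c k) (c (k + 1))) (hw : FreeTail.IsWitnessedChain 5 c j b)
    (hr0 : ∀ e ∈ (c 0).F.support, (c 0).r ≤ e) (hfloor : ∀ k, ordZero (c k).F ≠ 5) {k₀ : ℕ}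
    (hshade : ∀ k, k₀ ≤ k → (c k).shade = ((3 : ℕ) : ℕ∞))
    (hlight : ∀ k, k₀ ≤ k → (∀ i, (c k).r i ≤ 1) ∧ (c k).r.degree = 3) {k : ℕ} (hk : k₀ ≤ k) {x : Fin 4}
    (hbx : b k x ≠ 0) (hrx : (c k).r x = 1) :
    (c k).r (j k) = 0 ∧ (∀ i, i ≠ x → b k i ≠ 0 → (c k).r i = 0) ∧ (c (k + 1)).r x = 0 ∧
      (c (k + 1)).r (j k) = 1 := by
  obtain ⟨-, hlaw, hbj, -, -⟩ := three_weights_laws hc hw hr0 hfloor hshade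
  rcases light_step_cases hc hw hr0 hfloor hshade hlight hk with ⟨-, hno⟩ | ⟨hj0, hdeg1⟩
  · exact absurd (hno x hbx) (by omega)
  refine ⟨hj0, fun i hix hbi => ?_, ?_, ?_⟩
  · -- two translated weight-one letters would make the translated weight ≥ 2
    by_contra hri
    have hri1 : (c k).r i = 1 := by have := (hlight k hk).1 i; omega
    set g : Fin 4 →₀ ℕ := (c k).r.filter (fun i => ¬ b k i = 0) with hg
    have hgx : g x = 1 := by rw [hg, Finsupp.filter_apply, if_pos hbx, hrx]
    have hgi : g i = 1 := by rw [hg, Finsupp.filter_apply, if_pos hbi, hri1]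
    have h2 : g x + g i ≤ g.degree := by
      classical
      rw [Finsupp.degree_eq_sum]
      have h := Finset.sum_le_sum_of_subset (f := fun t => g t) (Finset.subset_univ ({x, i} : Finset (Fin 4)))
      rwa [Finset.sum_pair (Ne.symm hix)] at h
    omega
  · have h := law_apply (r := fun k => (c k).r) (hlaw k hk) x
    have hjx : x ≠ j k := fun h' => hbx (by rw [h']; exact hbj k)
    simp only [if_neg hjx, if_neg hbx] at h
    exact h
  · have h := law_apply_self (r := fun k => (c k).r) (hlaw k hk)
    rw [(hlight k hk).2] at h
    exact h

end Light

end ResCone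

end Summit.ResolutionOfSingularities.ResolutionOfSingularities.Theorems.PIDim4

end
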